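import Summits.BirchSwinnertonDyer.BirchSwinnertonDyer.Theses.ResidualThetaTransportAtTwo
import Summits.BirchSwinnertonDyer.BirchSwinnertonDyer.Theorems.ThetaPartnerAtTwoSignedControlAtTwoSignedEulerCharCount
import Summits.BirchSwinnertonDyer.Rank1Residual.X1.MuPart
import Literature.NumberTheory.EllipticCurves.Kobayashi2003.SignedSelmerModuleFiniteProofs
import Literature.NumberTheory.EllipticCurves.IwasawaEulerCharRankZeroProofs
import Literature.NumberTheory.EllipticCurves.PAdicBSDKatoFiniteProofs
import Literature.NumberTheory.EllipticCurves.MordellWeilRankZeroProofs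
import HarnessLib

/-!
# Route `ResidualThetaTransportAtTwo`, crux Kμ⁺ `SignedMuVanishingAtTwoPlus` (stmt-BirchSwinnertonDyer-20689):
# TORSION and a μ-BOUND BY DESCENT for the algebraic conjunct — under INJ^ε the `γ`-invariant count gives
# `X^ε` torsion and `p^{μ(X^ε)} ∣ #Sel_{p^∞}(E/ℚ) · p^{ord_p ∏ c_ℓ}`

Cell `bsd-wall`, width seat `bsd-wall-rtt-p4-w3` (g2) on the lead line `birth` v4.2. THEOREMS ONLY (no `def`, no named fact,
no `sorry`); helper `--supports` the crux; every input is a landed theorem consumed BY NAME; nothing about any particular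
curve is asserted; BSD is not proved by this. Sequel of this seat's `…SignedMuVanishingAtTwoPlusSelmerTrivialSeed`
(the case `#Sel · p^{ord_p Tam} = 1`: `Sel^ε(E/ℚ_∞) = 0`).

Conjunct 1 of Kμ⁺ asks, for every `+` signed Selmer dual datum `D` of a habitat⁺ curve at a cyclotomic pair, that `X = D.X`
be `Λ`-torsion AND have `μ = 0`. This file separates the two clauses against the local input INJ^ε of the shared crux
K4 `SignedControlAtTwo` (line `eulerchar`: INJ⁺@2 ⟸ HONDA⁺@2):

* §1 (`K = ℚ`, cyclotomic `κ`, ANY `p`, either sign, `Sel_{p^∞}(E/ℚ)` finite).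
  `isTorsion_of_localInj_of_finite_selmer` — **INJ^ε ⟹ every datum is finitely generated AND `Λ`-TORSION**
  (tp2-p3's `SignedEC.natCard_signedSelmerInvariants_mul_dvd_of_localInj`: `(Sel^ε_∞)^γ` finite; Greenberg's exercise
  `SignedSelmerDualData.isTorsion_of_finite_endInvariants`). So, granted K4's local residue, the TORSION clause of Kμ⁺'s
  conjunct 1 carries no research content beyond the finiteness of `Sel_{p^∞}(E/ℚ)`.
  `pow_mu_dvd_card_selmer_mul_of_localInj` — **`p^{μ(X^ε)} ∣ #Sel_{p^∞}(E/ℚ) · p^{ord_p ∏ c_ℓ}`**: Greenberg's Lemma 4.2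
  (iii) on the dual pair (`g(0) · #S_Γ = u · #S^Γ`, `IsDualPair.constantCoeff_charGenerator_mul_natCard_endCoinvariants`),
  `p^{μ(g)} ∣ g ⇒ p^{μ(g)} ∣ g(0)`, `μ(g) = μ(X)` (`MuPart.mu_generator_eq_muInvariant`), and the one-sided count
  `#S^Γ · #E[p^∞](ℚ) ∣ #Sel · p^{ord_p Tam}`; hence `mu_le_padicValNat_card_selmer_add_of_localInj`:
  **`μ(X^ε) ≤ ord_p #Sel_{p^∞}(E/ℚ) + ord_p ∏ c_ℓ`** — a DESCENT BOUND on the signed algebraic `μ`-invariant of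
  every rank-`0` member, the quantitative form of Kurihara's condition (∗).
* §2 (`p = 2`, the habitat⁺ of the route). `isTorsion_two_of_rankEq_of_localInj` — with the route's support item
  `RankEqAnalyticRankLeOne` (Gross–Zagier–Kolyvagin, BY NAME: `Sel_{2^∞}(W/ℚ)` is finite at analytic rank `0`) and INJ⁺@2
  at `W`: the torsion clause of conjunct 1 AT `W`; `mu_le_two_of_rankEq_of_localInj` — the descent bound at `W`. Reading:
  on a habitat⁺ class, `μ(X⁺_W) ≤ ord₂(#Sel_{2^∞}(W/ℚ) · Tam(W))` for EVERY member granted INJ⁺@2, and `μ = 0` for the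
  class as soon as ONE congruent member attains `0` (this seat's Selmer-trivial seed + the proved propagation 22891).

References: R. Greenberg, LNM 1716 (1999) §1 p. 61 (proof of Thm. 1.4), §4 Lemma 4.2–4.4 [GreenbergLNM1716]; M. Kurihara,
Invent. Math. 149 (2002) Thm. 0.1 [Kurihara2002]; B. D. Kim, J. Aust. Math. Soc. 95 (2013) Cor. 3.15 [BDKim2013];
S. Kobayashi, Invent. Math. 152 (2003) Thm. 1.2 [Kobayashi2003]; R. Greenberg, V. Vatsal, Invent. Math. 142 (2000) p. 2 (2)
[GreenbergVatsal2000]; L. Washington, GTM 83 §13.2 [Washington1997].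
-/

set_option autoImplicit false
set_option linter.dupNamespace false

noncomputable section

open scoped Classical NumberField MatrixGroups ModularForm

open NumberField IsDedekindDomain CongruenceSubgroup WeierstrassCurve
  Literature.NumberTheory.EllipticCurves Literature.NumberTheory.GaloisRepresentations
  Literature.NumberTheory.EllipticCurves.ModularForms Literature.NumberTheory.EllipticCurves.IwasawaAlgebra
  Literature.NumberTheory.EllipticCurves.IwasawaDual Literature.NumberTheory.EllipticCurves.Kobayashi2003
  Literature.NumberTheory.EllipticCurves.Rank1Residual Literature.NumberTheory.EllipticCurves.ZpExtension
  Summit.BirchSwinnertonDyer.Rank1Residual.X1 Summit.BirchSwinnertonDyer.Rank1Residual.X1.MuLambda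
  Summit.BirchSwinnertonDyer.BirchSwinnertonDyer.Theses.ResidualThetaTransportAtTwo

universe u

namespace Summit.BirchSwinnertonDyer.BirchSwinnertonDyer.Theorems.SelmerTrivialSeedAtTwo

/-! ## §0. `Λ`-algebra: `p^{μ(g)}` divides the constant term; `p`-power divisibility of naturals read in `ℤ_p` -/

/-- `p^{μ(g)} ∣ g(0)` in `ℤ_p` for `g ≠ 0` (`p^{μ(g)} ∣ g` in `Λ`, `MuLambda.C_pow_mu_dvd`, evaluated at `T = 0`).
[cite: GreenbergVatsal2000, p. 2, (2)] -/
theorem pow_mu_dvd_constantCoeff {p : ℕ} [Fact p.Prime] {g : IwasawaAlgebra p} (hg : g ≠ 0) :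
    (p : ℤ_[p]) ^ mu g ∣ PowerSeries.constantCoeff g := by
  obtain ⟨q, hq⟩ := C_pow_mu_dvd hg
  refine ⟨PowerSeries.constantCoeff q, ?_⟩
  have h := congrArg PowerSeries.constantCoeff hq
  rwa [map_mul, PowerSeries.constantCoeff_C] at h

/-- A power of `p` divides a natural number in `ℤ_p` iff it divides it in `ℕ`. [folklore] -/
theorem pow_dvd_natCast_iff {p : ℕ} [Fact p.Prime] (k n : ℕ) : (p : ℤ_[p]) ^ k ∣ (n : ℤ_[p]) ↔ p ^ k ∣ n := by
  rw [← Ideal.mem_span_singleton, ← PadicInt.norm_le_pow_iff_mem_span_pow, ← Int.cast_natCast,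
    PadicInt.norm_int_le_pow_iff_dvd]
  exact_mod_cast Int.natCast_dvd_natCast

/-! ## §1. `K = ℚ`, cyclotomic `κ`, any `p`, either sign: torsion and the descent `μ`-bound under INJ^ε -/

section AnyPrime

variable (W : WeierstrassCurve ℚ) [W.IsElliptic] (p : ℕ) [Fact p.Prime] (ε : ℤˣ)

/-- **INJ^ε ∧ `Sel_{p^∞}(E/ℚ)` finite ⟹ `X^ε(E/ℚ_∞)` is finitely generated and `Λ`-TORSION, for every dual datum.**
`(Sel^ε_∞)^γ` is finite by tp2-p3's one-sided count under INJ^ε; then Greenberg's exercise (`N·X ⊆ T·X`).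
[cite: GreenbergLNM1716, §1 p. 61 (proof of Thm. 1.4)] [cite: BDKim2013, proof of Cor. 3.15 (pp. 199–200)]
[cite: Kobayashi2003, Thm. 1.2 (the object)] -/
theorem isTorsion_of_localInj_of_finite_selmer {κ : ZpExtension ℚ p} (hκ : κ.IsCyclotomic)
    {γ : Field.absoluteGaloisGroup ℚ} (hγ : κ.IsTopGenerator γ)
    (hinj : ∀ v : HeightOneSpectrum (𝓞 ℚ), (p : 𝓞 ℚ) ∈ v.asIdeal →
      ∀ y ∈ (signedSelmerInfty W κ ε).comap (W.layerToInfty κ 0),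
        W.localResOver p (κ.layerSubgroup 0) (v.adicCompletion ℚ) y = 0)
    (hfin : Finite (W.selmerGroupPInfty p)) (D : SignedSelmerDualData W κ γ ε) :
    Module.Finite (IwasawaAlgebra p) D.X ∧ Module.IsTorsion (IwasawaAlgebra p) D.X :=
  ⟨D.moduleFinite hγ, D.isTorsion_of_finite_endInvariants hγ
    (SignedEC.natCard_signedSelmerInvariants_mul_dvd_of_localInj W p ε hκ hγ hinj hfin).1⟩

/-- **THE DESCENT μ-BOUND**: under INJ^ε and `Sel_{p^∞}(E/ℚ)` finite, for every dual datum `D` of `Sel^ε(E/ℚ_∞)`: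
**`p^{μ(X^ε)} ∣ #Sel_{p^∞}(E/ℚ) · p^{ord_p ∏ c_ℓ}`**. Chain: `char X = (g)` (Λ a UFD), `g(0) ≠ 0` and `g(0)·#S_Γ = u·#S^Γ`
(Greenberg's Lemma 4.2 on the dual pair), so `p^{μ(X)} = p^{μ(g)} ∣ g(0) ∣ #S^Γ ∣ #Sel · p^{ord_p Tam}` (one-sided count).
[cite: GreenbergLNM1716, §4 Lemma 4.2 (p. 102) and Lemmas 4.3–4.4] [cite: Kurihara2002, Thm. 0.1]
[cite: GreenbergVatsal2000, p. 2, (2)] [cite: Washington1997, §13.2] -/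
theorem pow_mu_dvd_card_selmer_mul_of_localInj {κ : ZpExtension ℚ p} (hκ : κ.IsCyclotomic)
    {γ : Field.absoluteGaloisGroup ℚ} (hγ : κ.IsTopGenerator γ)
    (hinj : ∀ v : HeightOneSpectrum (𝓞 ℚ), (p : 𝓞 ℚ) ∈ v.asIdeal →
      ∀ y ∈ (signedSelmerInfty W κ ε).comap (W.layerToInfty κ 0),
        W.localResOver p (κ.layerSubgroup 0) (v.adicCompletion ℚ) y = 0)
    (hfin : Finite (W.selmerGroupPInfty p)) (D : SignedSelmerDualData W κ γ ε) :
    p ^ D.mu ∣ Nat.card (W.selmerGroupPInfty p) * p ^ padicValNat p W.tamagawaProduct := by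
  obtain ⟨hfinΓ, hdvd⟩ := SignedEC.natCard_signedSelmerInvariants_mul_dvd_of_localInj W p ε hκ hγ hinj hfin
  haveI := D.moduleFinite hγ
  have htor : Module.IsTorsion (IwasawaAlgebra p) D.X := D.isTorsion_of_finite_endInvariants hγ hfinΓ
  -- a generator of the characteristic ideal
  obtain ⟨g, hg⟩ := (charIdeal_isPrincipal_holds p D.X).principal
  have hg' : D.charIdeal = Ideal.span {g} := hg
  have hgM : Module.charIdeal (IwasawaAlgebra p) D.X = Ideal.span {g} := hg
  have hg0c : PowerSeries.constantCoeff g ≠ 0 :=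
    (D.order_eq_zero_and_constantCoeff_ne_zero_of_finite_endInvariants hγ hfinΓ hg').2
  have hg0 : g ≠ 0 := by
    rintro rfl
    exact hg0c (map_zero _)
  -- `μ(X) = μ(g)` and `p^{μ(g)} ∣ g(0)`
  have hμ : D.mu = mu g := (MuPart.mu_generator_eq_muInvariant D.X htor hg0 hgM).symm
  -- Greenberg's Lemma 4.2 (iii) on the dual pair
  obtain ⟨u, hu⟩ := (D.isDualPair hγ).constantCoeff_charGenerator_mul_natCard_endCoinvariants htor g hgM hfinΓ
  have h1 : (p : ℤ_[p]) ^ D.mu ∣ (Nat.card (endInvariants (conjSignedSelmerInfty W κ ε γ - 1)) : ℤ_[p]) := by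
    have h2 : (p : ℤ_[p]) ^ D.mu ∣ (u : ℤ_[p]) * Nat.card (endInvariants (conjSignedSelmerInfty W κ ε γ - 1)) := by
      rw [← hu, hμ]
      exact (pow_mu_dvd_constantCoeff hg0).mul_right _
    exact (u.isUnit.dvd_mul_left).mp h2
  rw [pow_dvd_natCast_iff] at h1
  exact h1.trans ((Dvd.intro _ rfl).trans hdvd)

/-- **`μ(X^ε) ≤ ord_p #Sel_{p^∞}(E/ℚ) + ord_p ∏ c_ℓ`** under INJ^ε and `Sel_{p^∞}(E/ℚ)` finite — the descent bound in
valuation form. [cite: GreenbergLNM1716, §4 Lemma 4.2 (p. 102)] [cite: Kurihara2002, Thm. 0.1] -/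
theorem mu_le_padicValNat_card_selmer_add_of_localInj {κ : ZpExtension ℚ p} (hκ : κ.IsCyclotomic)
    {γ : Field.absoluteGaloisGroup ℚ} (hγ : κ.IsTopGenerator γ)
    (hinj : ∀ v : HeightOneSpectrum (𝓞 ℚ), (p : 𝓞 ℚ) ∈ v.asIdeal →
      ∀ y ∈ (signedSelmerInfty W κ ε).comap (W.layerToInfty κ 0),
        W.localResOver p (κ.layerSubgroup 0) (v.adicCompletion ℚ) y = 0)
    (hfin : Finite (W.selmerGroupPInfty p)) (D : SignedSelmerDualData W κ γ ε) :
    D.mu ≤ padicValNat p (Nat.card (W.selmerGroupPInfty p)) + padicValNat p W.tamagawaProduct := by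
  have h := pow_mu_dvd_card_selmer_mul_of_localInj W p ε hκ hγ hinj hfin D
  haveI := hfin
  have hSel0 : Nat.card (W.selmerGroupPInfty p) ≠ 0 := Nat.card_pos.ne'
  have hne : Nat.card (W.selmerGroupPInfty p) * p ^ padicValNat p W.tamagawaProduct ≠ 0 :=
    mul_ne_zero hSel0 (pow_ne_zero _ (Fact.out : p.Prime).ne_zero)
  have hle := (padicValNat_dvd_iff_le hne).mp h
  rwa [padicValNat.mul hSel0 (pow_ne_zero _ (Fact.out : p.Prime).ne_zero), padicValNat.prime_pow] at hle

end AnyPrime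

/-! ## §2. `p = 2` on the habitat⁺: the torsion clause of conjunct 1 and the descent bound, with GZK BY NAME -/

/-- `Sel_{p^∞}(W/ℚ)` is finite at analytic rank `0`, granted Gross–Zagier–Kolyvagin BY NAME (the route's support item
`RankEqAnalyticRankLeOne` = `rank_eq_analyticRank_of_analyticRank_le_one`: rank `0` and `Ш` finite; then
`finite_selmerGroupPInfty_iff`). [cite: Kolyvagin1990, Thm. (rank and Ш for analytic rank ≤ 1)] [cite: Greenberg1999LNM, §1 pp. 54–57] -/
theorem finite_selmerGroupPInfty_of_rankEq (hGZK : RankEqAnalyticRankLeOne) (W : WeierstrassCurve ℚ) [W.IsElliptic]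
    (p : ℕ) [Fact p.Prime] (hr : W.analyticRank = 0) : Finite (W.selmerGroupPInfty p) := by
  -- adapted from `Theorems.finite_selmerGroupPInfty_of_analyticRank_eq_zero` (ByReductionTypeAtTwoSupersingularLineEulerChar)
  obtain ⟨hrank, hfin⟩ := hGZK W (by omega)
  have hmw0 : W.mordellWeilRank = 0 := by rw [hrank, hr]
  haveI hE : Finite W.toAffine.Point := W.finite_point_of_rank_zero hmw0
  haveI := hfin
  haveI hS : Finite (AddCommGroup.primaryComponent W.sha p) :=
    Finite.of_injective (fun x : AddCommGroup.primaryComponent W.sha p ↦ (x : W.sha)) Subtype.val_injective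
  exact (W.finite_selmerGroupPInfty_iff p).mpr ⟨hE, hS⟩

/-- **The TORSION clause of Kμ⁺'s conjunct 1 AT a habitat⁺ curve `W` ⟸ GZK (by name) + INJ⁺@2 at `W`** — for every
cyclotomic pair and every `+` signed Selmer dual datum; no `μ`-statement, no seed, no transport.
[cite: GreenbergLNM1716, §1 p. 61 (proof of Thm. 1.4)] [cite: BDKim2013, proof of Cor. 3.15 (pp. 199–200)] -/
theorem isTorsion_two_of_rankEq_of_localInj (hGZK : RankEqAnalyticRankLeOne) (W : WeierstrassCurve ℚ) [W.IsElliptic]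
    (hr : W.analyticRank = 0)
    (hinj : ∀ (κ : ZpExtension ℚ 2), κ.IsCyclotomic →
      ∀ v : HeightOneSpectrum (𝓞 ℚ), (2 : 𝓞 ℚ) ∈ v.asIdeal →
      ∀ y ∈ (signedSelmerInfty W κ 1).comap (W.layerToInfty κ 0),
        W.localResOver 2 (κ.layerSubgroup 0) (v.adicCompletion ℚ) y = 0) :
    ∀ (κ : ZpExtension ℚ 2) (γ : Field.absoluteGaloisGroup ℚ), κ.IsCyclotomic → κ.IsTopGenerator γ →
      ∀ (D : SignedSelmerDualData W κ γ 1),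
        Module.Finite (IwasawaAlgebra 2) D.X ∧ Module.IsTorsion (IwasawaAlgebra 2) D.X :=
  fun κ _γ hκ hγ D ↦ isTorsion_of_localInj_of_finite_selmer W 2 1 hκ hγ (hinj κ hκ)
    (finite_selmerGroupPInfty_of_rankEq hGZK W 2 hr) D

/-- **The descent bound AT a habitat⁺ curve**: granted GZK (by name) and INJ⁺@2 at `W`, every `+` signed Selmer dual datum
has **`μ(X⁺) ≤ ord₂ #Sel_{2^∞}(W/ℚ) + ord₂ ∏ c_ℓ(W)`** — so `μ(X⁺_W) = 0` is CERTIFIED by a `2`-descent showing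
`#Sel_{2^∞}(W/ℚ) · Tam(W)` odd, and in general the `2`-descent of any rank-`0` member bounds the class's `μ`.
[cite: GreenbergLNM1716, §4 Lemma 4.2 (p. 102)] [cite: Kurihara2002, Thm. 0.1] [cite: KuriharaOtsuki2006, Rem. 0.2 (3)] -/
theorem mu_le_two_of_rankEq_of_localInj (hGZK : RankEqAnalyticRankLeOne) (W : WeierstrassCurve ℚ) [W.IsElliptic]
    (hr : W.analyticRank = 0) {κ : ZpExtension ℚ 2} (hκ : κ.IsCyclotomic) {γ : Field.absoluteGaloisGroup ℚ}
    (hγ : κ.IsTopGenerator γ)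
    (hinj : ∀ v : HeightOneSpectrum (𝓞 ℚ), (2 : 𝓞 ℚ) ∈ v.asIdeal →
      ∀ y ∈ (signedSelmerInfty W κ 1).comap (W.layerToInfty κ 0),
        W.localResOver 2 (κ.layerSubgroup 0) (v.adicCompletion ℚ) y = 0)
    (D : SignedSelmerDualData W κ γ 1) :
    D.mu ≤ padicValNat 2 (Nat.card (W.selmerGroupPInfty 2)) + padicValNat 2 W.tamagawaProduct :=
  mu_le_padicValNat_card_selmer_add_of_localInj W 2 1 hκ hγ hinj (finite_selmerGroupPInfty_of_rankEq hGZK W 2 hr) D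

/-- **Conjunct 1 of Kμ⁺ AT `W` from GZK + INJ⁺@2 + an odd `2`-descent at `W` itself** (`#Sel_{2^∞}(W/ℚ) · Tam(W)` odd):
torsion (§2) and `μ = 0` (the bound). [cite: Kurihara2002, Thm. 0.1] [cite: GreenbergLNM1716, §4 Lemma 4.2 (p. 102)] -/
theorem isTorsion_and_mu_eq_zero_two_of_rankEq_of_localInj_of_odd (hGZK : RankEqAnalyticRankLeOne)
    (W : WeierstrassCurve ℚ) [W.IsElliptic] (hr : W.analyticRank = 0) {κ : ZpExtension ℚ 2} (hκ : κ.IsCyclotomic)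
    {γ : Field.absoluteGaloisGroup ℚ} (hγ : κ.IsTopGenerator γ)
    (hinj : ∀ v : HeightOneSpectrum (𝓞 ℚ), (2 : 𝓞 ℚ) ∈ v.asIdeal →
      ∀ y ∈ (signedSelmerInfty W κ 1).comap (W.layerToInfty κ 0),
        W.localResOver 2 (κ.layerSubgroup 0) (v.adicCompletion ℚ) y = 0)
    (hodd : ¬ 2 ∣ Nat.card (W.selmerGroupPInfty 2) * W.tamagawaProduct) (D : SignedSelmerDualData W κ γ 1) :
    Module.IsTorsion (IwasawaAlgebra 2) D.X ∧ D.mu = 0 := by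
  have hfin := finite_selmerGroupPInfty_of_rankEq hGZK W 2 hr
  refine ⟨(isTorsion_of_localInj_of_finite_selmer W 2 1 hκ hγ hinj hfin D).2, ?_⟩
  have hle := mu_le_padicValNat_card_selmer_add_of_localInj W 2 1 hκ hγ hinj hfin D
  have hSel : ¬ 2 ∣ Nat.card (W.selmerGroupPInfty 2) := fun h ↦ hodd (h.mul_right _)
  have hTam : ¬ 2 ∣ W.tamagawaProduct := fun h ↦ hodd (h.mul_left _)
  rw [padicValNat.eq_zero_of_not_dvd hSel, padicValNat.eq_zero_of_not_dvd hTam, add_zero] at hle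
  exact Nat.le_zero.mp hle

end Summit.BirchSwinnertonDyer.BirchSwinnertonDyer.Theorems.SelmerTrivialSeedAtTwo

end
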